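import Mathlib
import Literature.MathematicalPhysics.QuantumFieldTheory.Balaban1983to89.B14Cor3
import Literature.MathematicalPhysics.QuantumFieldTheory.Balaban1983to89.B12TreeDecay

/-!
# `Balaban1983to89.B16Cor3` — [Balaban1989LargeFieldII] p. 387 and pp. 390–392: the B16 side of Corollary 3 —
"an improved bound (1.89) … implies the inequality (2.50) [III]" as KERNEL bookkeeping over the representation
(2.18)/(1.72), the decomposition (1.101), the form (1.102), the identity (1.103) and the alternative representation
(1.104) typed verbatim (schematic), the second exponentiation (1.103) → (1.104) as a NAMED UNPRINTED LEAF

CITATION HEADER (lean-in-tree rule 2026-08-18).  Source: T. Bałaban, *Large field renormalization. II. Localization,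
exponentiation, and bounds for the 𝐑 operation*, Commun. Math. Phys. **122**, 355–392 (1989),
doi:10.1007/bf01257421 (cell paper B16 = [V] of the large-field series; held: `paper:balaban1989-cmp122-large-field-ii`;
journal page = PDF page + 354; every quotation below is read from the page renders pp. 379–380 [25–26], 387 [33],
390–392 [36–38]), continuing the sibling module `B14Cor3` ([Balaban1988Convergent] = [III], Cor. 3 (2.50) p. 264 ⇐
five named leaves H, U1, U2, L1, L2 over the representation (2.18)).  Surge node T13.3 "sharpen"; the sibling modules
`B16` (unit b02), `B14`, `B14Cor3`, `Step` are NOT modified.  WHAT IS REPRODUCED (statement level):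

(a) THE PRINTED TEXT.  p. 387 [33], after the fundamental inequality *"𝐓′_k(X)1 ≤ exp(−2(1+β₀)⁻¹p₀(g_k)). (1.89)"*:
*"Next, we have noticed already that the inequality (1.79) holds for the 𝐓-operation connected with an arbitrary large
field region. The inequality (1.80) holds quite generally for such regions, hence also an improved bound (1.89), with
the additional term −κ₁d_k(X) in the exponential. This implies the inequality (2.50) [III], hence Corollary 3."*
p. 390 [36]: *"{…} = exp 𝐑′^{(k)} = exp Σ_X 𝐑′^{(k)}(X), (1.98)"*, the bounds (1.99)/(1.100) (typed verbatim in the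
sibling module `B16`: `B16.Ineq199`, `B16.Ineq1100`; the split into two groups is quoted at `Repr1101`), *"With the
above definitions we have completed the construction and the description of the new action after the k^th
transformation 𝐑T. We have A_k(1/(g_k(·))², U_k) = A′_k(1/(g_k(·))², U_k) + Σ_X 𝐑′^{(k)}(X, U_k) + Σ_X 𝐁′^{(k)}(X, U_k).
(1.101) This new action satisfies the induction hypothesis, as it follows from the construction and the properties of
the new terms. The new large field region is equal to Z_k ∪ ⋃_{i=1}^m Y_i, and the operation 𝐓_k for a component Y of
the set ⋃_{i=1}^m Y_i has the form 𝐓_k(Y) = χ^c_k(Y^{~−6}) χ_{k,Λ} δ_G(V_kV_Λ^{−1}) 𝐓′_k(Y). (1.102) From (1.72), (1.98),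
and the above definitions, it follows that the result 𝐑ρ_k of the 𝐑-operation can be written in the form (2.18) [III],
with all the expressions satisfying the induction hypothesis described in Sect. 2 [III]. This completes the proof of
Theorem 1 and Corollary 3."*  p. 391 [37]: (1.103), the "final remark" and (1.104) (quoted at their declarations
below); pp. 391–392: *"For this representation the domains Y_i are still large field domains, but
there are no integral operations connected with them, there are only the characteristic functions, the δ-functions and
the functions 𝐓′_k(Y_i)1 multiplying the action density, hence 𝐓_k(Y_i) is the multiplication operation. … The
representation (1.104) can be used alternatively in the inductive description of the effective actions, and the above
considerations leading to it give the proof of Theorem 1."*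

(b) THE TYPED READING.  (§1) The sentence *"This implies the inequality (2.50) [III]"* IS the following finite
combinatorics, kernel-checked here with every geometric input displayed as a hypothesis: a per-region weight
`w(Y) = exp(−c − κ₁d_k(Y))` (the improved (1.89), `FundIneq189Improved`, which implies the sibling `Step.FundIneq189`
region by region, `fundIneq189_of_improved`) together with the tree-decay ("entropy") input of [I] p. 257 / (0.26)
`Σ_{X ⊃ □} exp(−κ₁d_k(X)) ≤ K₀` (`B12.CubeCover`, hypothesis; DISCHARGED BY NAME from the sibling `B12TreeDecay.hTree_of_volumeLeaf`
modulo its quoted volume leaf, `lfWeightSum_le_of_volumeLeaf`) gives `Σ_{families W of regions} Π_{Y∈W} w(Y) =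
Π_Y (1 + w(Y)) ≤ exp(Σ_Y w(Y)) ≤ exp(|π_k| e^{−c} K₀)` (`sum_powerset_prod_eq`, `sum_powerset_prod_le_exp`,
`sum_le_card_mul`, `lfFamilySum_le_exp`) — the shape of leaf U2 of `B14Cor3` with `E₊`-rate `e^{−c}K₀M⁻⁴`, once the
summands of (2.18) are indexed injectively by their families of regions and majorised by `e^{E′|T|} Π_{Y} w(Y)`
(`sum_major_le_exp`; that majorisation is leaf U1 + the (3.42) [Balaban1982Higgs2]-type structure asserted by
similarity in [III] p. 264, cell GAPS G-adv3-1 — NOT proved here).  (§2) For the LOWER half: (1.100) pointwise +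
the same entropy input give `‖Σ_X 𝐑′^{(k)}(X)‖ ≤ e^{−p₀(g_k)} K₀ |π_k|` (`norm_sumR_le`), and a summand of the printed
form `χ · exp[A′_k + Σ_X 𝐑′^{(k)}(X)]` (the "term without large field regions", `Z_k = ∅, m = 0`, of (1.72)+(1.98) or of
(1.104): cell GAPS C-B16-9, unit b02-g2 — NOT history-clean: the erased histories are carried inside `exp Σ𝐑′` and
`A′_k` as an identity) is bounded below by `χ exp[−g_k⁻²A(U_k) − (E₁ + e^{−p₀(g_k)}K₀M⁻⁴)|T|]` as soon as `A′_k ≥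
−g_k⁻²A(U_k) − E₁|T|` on the support of `χ` (`allSmall_lower`) — the shape of leaf L2 of `B14Cor3`; the located
UNPRINTED inputs are exactly `A′_k ≥ …` ((2.49) [III]-bookkeeping of the E-, 𝐑^{(j)}-, 𝐁^{(j)}-terms, cell GAPS
G-adv3-2 (L2)) and the reality/positivity leaf L1 (G-adv3-2, G-adv3-2a, C-B16-9 (L1′)).  `uvIneq_of_structure`
composes both halves with `B14Cor3.uvIneq_of_termData` into `B16.UVIneq` (one run, one step) with the explicit
constants `E₋ = E₁ + e^{−p₀(g_k)}K₀M⁻⁴`, `E₊ = E′ + e^{−c}K₀M⁻⁴`.  (§3) (1.101) = the split of the (1.98)-sum by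
"X meets the large-field set" (`Repr1101`, `repr1101_of_198`, over the sibling `B16.RelDomainSys`); (1.102) = a
factorisation into a multiplication factor and 𝐓′_k(Y) (`Form1102`; READING v1.1: (1.102) as printed shows three factors in
front of 𝐓′_k(Y), while (1.72) line 3 p. 379, (1.104) line 1 p. 391 and the text p. 378 carry four — the small-field function
χ_i = χ(Λ∩Y) is dropped in (1.102); adopted reading at `Form1102`, cell GAPS C-adv7-91); (1.103) = the normalisation identity, valid iff
every `𝐓′_k(Y_i)1 ≠ 0` (`identity1103`; (1.74) p. 380, cell GAPS G-adv3-2a).  (§4) (1.104) as a STRUCTURE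
(`Repr1104`, `Repr1104.Holds`) whose `Z_k = ∅, m = 0` summand has the form used in §2 (`Repr1104.allSmall_term`), and
the second exponentiation of the "final remark" as the named leaf `SecondExpLeaf` — cell GAPS G-B16-11 (unit b02-g2,
adjudicating G-adv3-4 against C-B16-8): OBJECTION UPHELD — the printed justification (*"looking carefully at a standard
proof of the convergence of the expansion (e.g., in [26]), we see that in the present situation such factors are not
needed, because there are no summations over these domains, they are fixed"*) does not give the absolute convergence a
standard proof needs (polymers ⊇ a fixed Y_i are pairwise incompatible); (1.104) is NOT established in print and NOT load-bearing for Theorem 1 / Corollary 3, whose main line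
is (1.72)+(1.98) (p. 390 "This completes the proof of Theorem 1 and Corollary 3").  Nothing here relies on
`SecondExpLeaf`; it is recorded so that a consumer of (1.104) must name it.

WHAT IS *NOT* REPRODUCED OR ASSERTED: (1.72), (1.89), (1.98)–(1.100), (2.18), (2.49) themselves (hypotheses only);
the cube geometry (`Setup.LocDomainSys` / `B12.CubeCover` abstract the domains, cell DIVERGENCE F5); the operators
𝐓′_k, 𝐓″_k (functions resp. an abstract endomorphism here); the INJECTIVE indexing of the summands of (2.18) by families
of regions and the majorisation `term ≤ e^{E′|T|} Π w` (hypotheses of `sum_major_le_exp` / `uvIneq_of_structure` — in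
the honest instance the region type distinguishes live from erased components and the scales j ≤ k within the
𝐑-horizon: cell GAPS G-pv06-1 / C-f2.7 / C-B16-9 on the k-uniformity of E_±); the entropy constant K₀ ([I] (0.26),
[II] (1.26): kernel-checked in the sibling `B12TreeDecay` modulo the volume leaf); reality of `A′_k + Σ𝐑′` on real fields.  Instantiated with trivial data the theorems restate their
hypotheses — the content is the printed STRUCTURE with each leaf located, not an estimate.  NOTHING of the series is
asserted; value = typed skeleton + located gaps, NOT summit progress.  Unit `b2b-balaban-pv06-g2` (surge node prover
#06, gen 2); companion rows: cell `GAPS.md` C-pv06-2 (this certification), G-adv3-1, G-adv3-2, G-adv3-2a, G-B16-11,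
C-B16-8, C-B16-9, G-pv06-1; `DIVERGENCE.md` D-pv06.2.

v1.1 (unit `b2b-balaban-pv06-g14`, gen 14; DOCFIX, docstring-only — no declaration added, removed or re-typed): two READING
NOTES adopted from the cell's referee rows GAPS C-adv7-91 and C-adv7-93 (unit adv7-g43; routed here by f2-g24, cell
`DIVERGENCE.md` D-f2.23) — at `Form1102` (the factor χ_i = χ(Λ∩Y) of (1.72)/(1.104), absent from (1.102) as printed) and at
`SecondExpLeaf` (p. 391 "the 𝐓′_k-operations are normalized": the normalized operations are the bracket operations
(𝐓′_k(Y_i)1)⁻¹𝐓′_k(Y_i) of (1.103)); companion row C-pv06g14-2.  Every typed `Prop` is unaffected.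
-/

namespace Literature.MathematicalPhysics.QuantumFieldTheory.Balaban1983to89.B16Cor3

open Literature.MathematicalPhysics.QuantumFieldTheory.Balaban1983to89

/-! ## 1. "This implies the inequality (2.50) [III]" (p. 387): the improved (1.89) and the entropy estimate -/

/-- **The improved fundamental inequality** p. 387 [33], verbatim: *"hence also an improved bound (1.89), with the
additional term −κ₁d_k(X) in the exponential"*, i.e. `𝐓′_k(X)1 ≤ exp(−2(1+β₀)⁻¹p₀(g_k) − κ₁d_k(X))` for every
large-field region `X` of the k-th step, pointwise in the remaining variables `v` (`T1 X v` = `(𝐓′_k(X)1)(v)`), over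
the abstract system of localization domains `S` (`d_k = S.dj`), `p₀(g_k) = p0Profile A₀ p₀ g_k`.  The sibling
`Step.FundIneq189` is the case `κ₁ = 0` for one region. [cite: Balaban1989LargeFieldII, (1.89) p.387] -/
def FundIneq189Improved {V : Type*} (S : LocDomainSys) (T1 : S.Dom → V → ℝ) (A₀ : ℝ) (p₀ : ℕ)
    (β₀ κ₁ gk : ℝ) : Prop :=
  ∀ X v, T1 X v ≤ Real.exp (-(2 * (1 + β₀)⁻¹ * p0Profile A₀ p₀ gk) - κ₁ * S.dj X)

/-- The improved bound implies (1.89) itself (`Step.FundIneq189`) for each region, since `κ₁d_k(X) ≥ 0`. [folklore] -/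
theorem fundIneq189_of_improved {V : Type*} (S : LocDomainSys) (T1 : S.Dom → V → ℝ) (A₀ : ℝ) (p₀ : ℕ)
    (β₀ κ₁ gk : ℝ) (hκ₁ : 0 ≤ κ₁) (h : FundIneq189Improved S T1 A₀ p₀ β₀ κ₁ gk) (X : S.Dom) :
    Step.FundIneq189 (T1 X) A₀ p₀ β₀ gk := by
  intro v
  refine (h X v).trans (Real.exp_le_exp.mpr ?_)
  nlinarith [mul_nonneg hκ₁ (S.dj_nonneg X)]

/-- Sum over all subfamilies: `Σ_{W ⊆ s} Π_{Y∈W} w(Y) = Π_{Y∈s} (1 + w(Y))`. [folklore] -/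
theorem sum_powerset_prod_eq {ι : Type*} (s : Finset ι) (w : ι → ℝ) :
    ∑ W ∈ s.powerset, ∏ Y ∈ W, w Y = ∏ Y ∈ s, (1 + w Y) := by
  classical
  exact (Finset.prod_one_add s).symm

/-- … hence `≤ exp(Σ_{Y∈s} w(Y))` for non-negative weights (`1 + w ≤ e^w`).  This is the geometry-free half of the
"combinatorics as in [6] (3.42)" of [III] p. 264 / of *"This implies the inequality (2.50) [III]"* here: dropping the
compatibility (disjointness) constraints between large-field regions only enlarges the sum. [folklore] -/
theorem sum_powerset_prod_le_exp {ι : Type*} (s : Finset ι) (w : ι → ℝ) (hw : ∀ Y ∈ s, 0 ≤ w Y) :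
    ∑ W ∈ s.powerset, ∏ Y ∈ W, w Y ≤ Real.exp (∑ Y ∈ s, w Y) := by
  rw [sum_powerset_prod_eq, Real.exp_sum]
  refine Finset.prod_le_prod (fun Y hY => by linarith [hw Y hY]) fun Y _ => ?_
  linarith [Real.add_one_le_exp (w Y)]

/-- The entropy half, [I] p. 257–258 (the second and third members of (0.26)/(0.30)) in the form used here: if for
every cube `□ ∈ π_k` the weights of the domains containing it sum to `≤ ε`, then the total weight is `≤ |π_k| ε`
(`B12.sum_le_sum_cubes`: every domain contains a cube). [folklore] -/
theorem sum_le_card_mul {S : LocDomainSys} (C : B12.CubeCover S) (w : S.Dom → ℝ) (hw : ∀ X, 0 ≤ w X) (ε : ℝ)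
    (hc : ∀ c : C.Cube, ∑ X ∈ C.above c, w X ≤ ε) :
    ∑ X, w X ≤ (Fintype.card C.Cube : ℝ) * ε := by
  calc ∑ X, w X ≤ ∑ c : C.Cube, ∑ X ∈ C.above c, w X := B12.sum_le_sum_cubes C w hw
    _ ≤ ∑ _c : C.Cube, ε := Finset.sum_le_sum fun c _ => hc c
    _ = (Fintype.card C.Cube : ℝ) * ε := by
        rw [Finset.sum_const, Finset.card_univ, nsmul_eq_mul]

/-- The total improved-(1.89) weight: with `w(Y) = exp(−c − κ₁d_k(Y))` and the tree-decay input `Σ_{X ⊃ □}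
exp(−κ₁d_k(X)) ≤ K₀` ([I] p. 257, hypothesis), `Σ_Y w(Y) ≤ |π_k| · e^{−c}K₀` — the quantity `E` of `sum_major_le_exp`
and `Ep′·N` of `uvIneq_of_structure` (`|π_k| = M⁻⁴N`). [folklore] -/
theorem lfWeightSum_le (S : LocDomainSys) (C : B12.CubeCover S) (c κ₁ K₀ : ℝ)
    (hTree : ∀ cb : C.Cube, ∑ X ∈ C.above cb, Real.exp (-κ₁ * S.dj X) ≤ K₀) :
    ∑ Y, Real.exp (-c - κ₁ * S.dj Y) ≤ (Fintype.card C.Cube : ℝ) * (Real.exp (-c) * K₀) := by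
  refine sum_le_card_mul C _ (fun Y => (Real.exp_pos _).le) _ fun cb => ?_
  have hsplit : ∑ X ∈ C.above cb, Real.exp (-c - κ₁ * S.dj X)
      = Real.exp (-c) * ∑ X ∈ C.above cb, Real.exp (-κ₁ * S.dj X) := by
    rw [Finset.mul_sum]
    refine Finset.sum_congr rfl fun X _ => ?_
    rw [← Real.exp_add]
    congr 1
    ring
  rw [hsplit]
  exact mul_le_mul_of_nonneg_left (hTree cb) (Real.exp_pos _).le


/-- The tree-decay leaf `hTree` DISCHARGED BY NAME from the tree: `B12TreeDecay.hTree_of_volumeLeaf` ((1.26) [II] =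
(0.26) [I], kernel-checked there from the lattice-animal count modulo the quoted volume leaf `|X|_M ≤ c₀(1 + d(X))`,
a degree bound `Δ` on the cube adjacency and `κ₁ ≥ κ₀(c₀,Δ)`), plugged into `lfWeightSum_le` over the induced cube
cover: the large-field weight sum with `K₀ = K₀(c₀,Δ)`.  Pure composition (types match: same `above`, same `d`). [cite: Balaban1988RG2Cluster, (1.26) p.8] -/
theorem lfWeightSum_le_of_volumeLeaf (S : LocDomainSys) (G : B12TreeDecay.CubeSystem S) {Δ : ℕ}
    (hΔ : G.DegreeLE Δ) {c₀ : ℝ} (hV : G.VolumeLeaf c₀) {κ₁ : ℝ} (hκ : B12TreeDecay.kappa₀ c₀ Δ ≤ κ₁) (c : ℝ) :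
    ∑ Y, Real.exp (-c - κ₁ * S.dj Y)
      ≤ (Fintype.card G.toCubeCover.Cube : ℝ) * (Real.exp (-c) * B12TreeDecay.K₀ c₀ Δ) :=
  lfWeightSum_le S G.toCubeCover c κ₁ _ (B12TreeDecay.hTree_of_volumeLeaf G hΔ hV hκ)
/-- **The large-field family sum.**  With the improved-(1.89) weights `w(Y) = exp(−c − κ₁d_k(Y))` (`c =
2(1+β₀)⁻¹p₀(g_k)`, or what is left of it after the volume terms of (1.69)/(2.49) are paid) and the tree-decay input
`Σ_{X ⊃ □} exp(−κ₁d_k(X)) ≤ K₀` ([I] p. 257, hypothesis), the sum over ALL families of regions of the products of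
weights is `≤ exp(|π_k| · e^{−c}K₀)`: extensive in the number of M-cubes with a rate that tends to 0 with `g_k`. [cite: Balaban1989LargeFieldII, p.387 after (1.89)] -/
theorem lfFamilySum_le_exp (S : LocDomainSys) (C : B12.CubeCover S) (c κ₁ K₀ : ℝ)
    (hTree : ∀ cb : C.Cube, ∑ X ∈ C.above cb, Real.exp (-κ₁ * S.dj X) ≤ K₀) :
    ∑ W ∈ (Finset.univ : Finset S.Dom).powerset, ∏ Y ∈ W, Real.exp (-c - κ₁ * S.dj Y)
      ≤ Real.exp ((Fintype.card C.Cube : ℝ) * (Real.exp (-c) * K₀)) :=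
  (sum_powerset_prod_le_exp _ _ fun _ _ => (Real.exp_pos _).le).trans
    (Real.exp_le_exp.mpr (lfWeightSum_le S C c κ₁ K₀ hTree))

/-- **The shape of leaf U2 of `B14Cor3`.**  If the summands `a` of the representation (2.18) are indexed INJECTIVELY
by their families of large-field regions `fam a` (a finite region type `ι`; in the honest instance it distinguishes
live from erased components and the scales within the 𝐑-horizon), each majorant is `≤ B₀ Π_{Y ∈ fam a} w(Y)` with a
common factor `B₀ ≥ 0` (the volume terms `e^{E′|T|}`) and non-negative weights, and the total weight is `≤ E`, then
`Σ_a major(a) ≤ B₀ e^{E}`.  Finite combinatorics: the image of `fam` is a subfamily of all families. [cite: Balaban1988Convergent, p.264 paragraph before Cor. 3] -/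
theorem sum_major_le_exp {A ι : Type*} [Fintype A] [Fintype ι] (major : A → ℝ) (fam : A → Finset ι)
    (hinj : Function.Injective fam) (w : ι → ℝ) (hw : ∀ Y, 0 ≤ w Y) (B₀ E : ℝ) (hB₀ : 0 ≤ B₀)
    (hmaj : ∀ a, major a ≤ B₀ * ∏ Y ∈ fam a, w Y) (hE : ∑ Y, w Y ≤ E) :
    ∑ a, major a ≤ B₀ * Real.exp E := by
  classical
  have hall : ∑ W ∈ (Finset.univ : Finset ι).powerset, ∏ Y ∈ W, w Y ≤ Real.exp E :=
    (sum_powerset_prod_le_exp _ _ fun Y _ => hw Y).trans (Real.exp_le_exp.mpr hE)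
  calc ∑ a, major a ≤ ∑ a, B₀ * ∏ Y ∈ fam a, w Y := Finset.sum_le_sum fun a _ => hmaj a
    _ = B₀ * ∑ a, ∏ Y ∈ fam a, w Y := by rw [Finset.mul_sum]
    _ = B₀ * ∑ W ∈ Finset.univ.image fam, ∏ Y ∈ W, w Y := by
        rw [Finset.sum_image fun a _ b _ h => hinj h]
    _ ≤ B₀ * ∑ W ∈ (Finset.univ : Finset ι).powerset, ∏ Y ∈ W, w Y := by
        refine mul_le_mul_of_nonneg_left ?_ hB₀
        exact Finset.sum_le_sum_of_subset_of_nonneg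
          (fun W _ => Finset.mem_powerset.mpr (Finset.subset_univ W))
          (fun W _ _ => Finset.prod_nonneg fun Y _ => hw Y)
    _ ≤ B₀ * Real.exp E := mul_le_mul_of_nonneg_left hall hB₀

/-! ## 2. The lower half: (1.100) summed, and the "term without large field regions" -/

/-- (1.100) p. 390 [36] summed over the localization domains of the k-th step at one configuration `φ`: from
`|𝐑′^{(k)}(X)| ≤ exp(−p₀(g_k)) exp(−κd_k(X))` (the sibling `B16.Ineq1100`, here pointwise at `φ`) and the tree-decay
input `Σ_{X ⊃ □} exp(−κd_k(X)) ≤ K₀`, `‖Σ_X 𝐑′^{(k)}(X)‖ ≤ e^{−p₀(g_k)} K₀ |π_k|` — the "|Σ𝐑′^{(k)}| ≤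
e^{−p₀(g_k)}·O(M^{−d}|T|)" of cell GAPS C-B16-9 (L2′). [cite: Balaban1989LargeFieldII, (1.100) p.390] -/
theorem norm_sumR_le {Φ : Type*} (S : LocDomainSys) (C : B12.CubeCover S) (R' : S.Dom → Φ → ℂ)
    (p0val κ K₀ : ℝ) (φ : Φ)
    (h100 : ∀ X, ‖R' X φ‖ ≤ Real.exp (-p0val) * Real.exp (-κ * S.dj X))
    (hTree : ∀ cb : C.Cube, ∑ X ∈ C.above cb, Real.exp (-κ * S.dj X) ≤ K₀) :
    ‖∑ X, R' X φ‖ ≤ Real.exp (-p0val) * K₀ * (Fintype.card C.Cube : ℝ) := by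
  calc ‖∑ X, R' X φ‖ ≤ ∑ X, ‖R' X φ‖ := norm_sum_le _ _
    _ ≤ ∑ X, Real.exp (-p0val) * Real.exp (-κ * S.dj X) := Finset.sum_le_sum fun X _ => h100 X
    _ = Real.exp (-p0val) * ∑ X, Real.exp (-κ * S.dj X) := by rw [Finset.mul_sum]
    _ ≤ Real.exp (-p0val) * ((Fintype.card C.Cube : ℝ) * K₀) :=
        mul_le_mul_of_nonneg_left
          (sum_le_card_mul C _ (fun X => (Real.exp_pos _).le) K₀ hTree) (Real.exp_pos _).le
    _ = Real.exp (-p0val) * K₀ * (Fintype.card C.Cube : ℝ) := by ring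

/-- The real part of the summed 𝐑-terms is then within `± e^{−p₀(g_k)} K₀ |π_k|` (what enters `exp[A′_k + Σ𝐑′]` on
real fields, where the exponent is real — leaf L1). [folklore] -/
theorem abs_re_sumR_le {Φ : Type*} (S : LocDomainSys) (C : B12.CubeCover S) (R' : S.Dom → Φ → ℂ)
    (p0val κ K₀ : ℝ) (φ : Φ)
    (h100 : ∀ X, ‖R' X φ‖ ≤ Real.exp (-p0val) * Real.exp (-κ * S.dj X))
    (hTree : ∀ cb : C.Cube, ∑ X ∈ C.above cb, Real.exp (-κ * S.dj X) ≤ K₀) :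
    |(∑ X, R' X φ).re| ≤ Real.exp (-p0val) * K₀ * (Fintype.card C.Cube : ℝ) :=
  (Complex.abs_re_le_norm _).trans (norm_sumR_le S C R' p0val κ K₀ φ h100 hTree)

/-- **The shape of leaf L2 of `B14Cor3`** from the printed FORM of the term without large field regions.  If a
summand has the form `term(V) = χ(V) · exp[A′(V) + R(V)]` (the `Z_k = ∅, m = 0` summand of (1.72)+(1.98) p. 379/390,
or of (1.104): `(Σ_{{Ω^c_j,Z_j}}𝐓″_k(∅)) = 1`, no factors `𝐓_k(Y_i)`, no boundary terms 𝐁′^{(k)}; cell GAPS C-B16-9), with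
`χ ≥ 0`, `A′ ≥ −g⁻²A(U_k(V)) − E₁N` wherever `χ ≠ 0` (the (2.49) [III]-bookkeeping of the terms of `A′_k`, UNPRINTED
as a lower bound: cell GAPS G-adv3-2 (L2)) and `|R| ≤ εN` (`abs_re_sumR_le`), then `χ exp[−g⁻²A(U_k(V)) − (E₁+ε)N]
≤ term(V)` — the all-small-field lower bound with `E₋ = E₁ + ε`. [cite: Balaban1988Convergent, (2.49)–(2.50) p.264] -/
theorem allSmall_lower {Cfg : Type*} (χ term A' R wil : Cfg → ℝ) (g E₁ ε N : ℝ)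
    (hform : ∀ V, term V = χ V * Real.exp (A' V + R V))
    (hχ : ∀ V, 0 ≤ χ V)
    (hA' : ∀ V, χ V ≠ 0 → -(1 / g ^ 2 * wil V) - E₁ * N ≤ A' V)
    (hR : ∀ V, |R V| ≤ ε * N) :
    ∀ V, χ V * Real.exp (-(1 / g ^ 2 * wil V) - (E₁ + ε) * N) ≤ term V := by
  intro V
  rw [hform V]
  by_cases h0 : χ V = 0
  · rw [h0, zero_mul, zero_mul]
  · refine mul_le_mul_of_nonneg_left (Real.exp_le_exp.mpr ?_) (hχ V)
    have h1 := hA' V h0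
    have h2 : -(ε * N) ≤ R V := (abs_le.mp (hR V)).1
    linarith

/-- **One run, one step: (2.50)/(0.1) from the B16-side structure**, composing §1–§2 with
`B14Cor3.uvIneq_of_termData`.  Data: the representation (2.18) `R` of `ρ_k` (leaf H: `R.Holds`); a finite region type
`ι` with non-negative weights indexing the summands injectively (`fam`), a common volume factor `exp(E′N)` and the
majorisation U1 + `major a ≤ exp(E′N) Π_{Y∈fam a} w(Y)`, total weight `≤ Ep′N` (`lfWeightSum_le`-type entropy
bounds); leaf L1; the printed form of the all-small summand (`hform`, including the identification of its
characteristic function with `χ_k(T_η)` of (2.17)/(2.50) [III] = `D.χ k`) with its two inputs (`allSmall_lower`).  Conclusion: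
`B16.UVIneq` at every configuration with `E₋ = E₁ + ε`, `E₊ = E′ + Ep′` (`N = |T₁^{(k)}|`).  Every constant depending
on `g_k` enters through `e^{−p₀(g_k)}`, `e^{−c(g_k)}` (bounded on ]0, γ]); the volume constants `E₁, E′` are the
`O(1)Σ_j|Γ_j|`-terms of (2.49) [III] / (1.69), whose k-uniformity is cell GAPS G-pv06-1 / C-f2.7 / C-B16-9. [cite: Balaban1989LargeFieldII, (0.1) p.356] -/
theorem uvIneq_of_structure (D : B16.RunData) (k : ℕ) (R : B14Cor3.TermData D k)
    {ι : Type} [Fintype ι] (fam : R.Adm → Finset ι) (w : ι → ℝ)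
    (A' Rre : D.Cfg k → ℝ) (E₁ ε E' Ep' : ℝ)
    (hH : R.Holds)
    (hU1 : ∀ a V, R.term a V ≤ R.major a)
    (hinj : Function.Injective fam) (hw : ∀ Y, 0 ≤ w Y)
    (hmaj : ∀ a, R.major a ≤ Real.exp (E' * (D.numSites k : ℝ)) * ∏ Y ∈ fam a, w Y)
    (hE : ∑ Y, w Y ≤ Ep' * (D.numSites k : ℝ))
    (hL1 : ∀ a V, 0 ≤ R.term a V)
    (hform : ∀ V, R.term R.allSmall V = D.χ k V * Real.exp (A' V + Rre V))
    (hχ : ∀ V, 0 ≤ D.χ k V)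
    (hA' : ∀ V, D.χ k V ≠ 0 →
      -(1 / (D.flow.g k) ^ 2 * D.wilsonBG k V) - E₁ * (D.numSites k : ℝ) ≤ A' V)
    (hR : ∀ V, |Rre V| ≤ ε * (D.numSites k : ℝ)) :
    ∀ V : D.Cfg k, B16.UVIneq D k V (E₁ + ε) (E' + Ep') := by
  refine B14Cor3.uvIneq_of_termData D k R (E₁ + ε) (E' + Ep') hH hU1 ?_ hL1 ?_
  · have h := sum_major_le_exp R.major fam hinj w hw _ _ (Real.exp_pos _).le hmaj hE
    rw [← Real.exp_add] at h
    convert h using 2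
    ring
  · exact allSmall_lower (D.χ k) (R.term R.allSmall) A' Rre (D.wilsonBG k) (D.flow.g k) E₁ ε
      (D.numSites k : ℝ) hform hχ hA' hR

/-- `p₀(g) = A₀(log g⁻²)^{p₀} ≥ 0` for `0 < g ≤ 1`, `A₀ ≥ 0`. [folklore] -/
theorem p0Profile_nonneg (A₀ g : ℝ) (p₀ : ℕ) (hg : 0 < g) (hg1 : g ≤ 1) (hA : 0 ≤ A₀) :
    0 ≤ p0Profile A₀ p₀ g := by
  unfold p0Profile
  have hl : 0 ≤ Real.log (g ^ 2)⁻¹ := by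
    apply Real.log_nonneg
    have h2 : g ^ 2 ≤ 1 := by nlinarith
    exact one_le_inv_iff₀.mpr ⟨by positivity, h2⟩
  positivity

/-- **Where the g_k-dependence of E_± sits.**  The rates produced above are `E₁ + e^{−p₀(g_k)}K₀M⁻⁴` and `E′ +
e^{−t·p₀(g_k)}K₀M⁻⁴` (`t = 2(1+β₀)⁻¹` or smaller); their g_k-dependent parts are `≤ K₀M⁻⁴` on ]0, 1] (`e^{−t p₀(g)} ≤ 1`),
so the boundedness hypotheses `hbm`/`hbp` of `B14Cor3.uvBound01_of_leaves` — the printed difference between [III]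
Cor. 3 *"depending on g_k"* and (0.1) *"independent of k"* (cell GAPS G-r2.7, G-B16-08 (d)) — reduce to the volume
constants `E₁, E′` alone (the `O(1)Σ_j|Γ_j|` terms; cell GAPS G-pv06-1).  Elementary. [folklore] -/
theorem depFun_bounded (E K A₀ t γ : ℝ) (p₀ : ℕ) (hA : 0 ≤ A₀) (ht : 0 ≤ t) (hK : 0 ≤ K) (hγ1 : γ ≤ 1) :
    ∃ B : ℝ, ∀ x, 0 < x → x ≤ γ → E + Real.exp (-(t * p0Profile A₀ p₀ x)) * K ≤ B := by
  refine ⟨E + K, fun x hx hxγ => ?_⟩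
  have hp : 0 ≤ t * p0Profile A₀ p₀ x := mul_nonneg ht (p0Profile_nonneg A₀ x p₀ hx (hxγ.trans hγ1) hA)
  have h1 : Real.exp (-(t * p0Profile A₀ p₀ x)) ≤ 1 := Real.exp_le_one_iff.mpr (by linarith)
  nlinarith

/-! ## 3. (1.101), (1.102), (1.103) typed verbatim (schematic carriers) -/

section Displays

variable (S : B16.RelDomainSys) [DecidablePred S.MeetsLF]

/-- **(1.101)** p. 390 [36], verbatim: *"The exponentiation (1.98) completes the 𝐑-operation. Now we divide the terms
𝐑′^{(k)}(X) into two groups. To the first group we assign all the terms with the localization domains X intersecting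
the large field region Z_k^~ ∪ ⋃_{i=1}^m Y_i^~, to the second group the terms with the domains disjoint with this
region. The terms of the first group are new boundary terms, and they are denoted by 𝐁′^{(k)}(X). The terms of the
second group give the basic contribution to the 𝐑-terms in the k^th renormalization step. … With the above definitions
we have completed the construction and the description of the new action after the k^th transformation 𝐑T. We have
A_k(1/(g_k(·))², U_k) = A′_k(1/(g_k(·))², U_k) + Σ_X 𝐑′^{(k)}(X, U_k) + Σ_X 𝐁′^{(k)}(X, U_k). (1.101)"* — over the sibling
carrier `B16.RelDomainSys` (`MeetsLF X` = "X intersects `Z_k^~ ∪ ⋃_i Y_i^~`"), `R'` = the family of ALL terms of (1.98)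
(both groups), `A'` = `A′_k`, `A` = the new action `A_k`, as functions of the (complex) configuration; first sum = second
group (new 𝐑-terms), second sum = first group (new boundary terms). [cite: Balaban1989LargeFieldII, (1.101) p.390] -/
def Repr1101 {Φ : Type*} (A A' : Φ → ℂ) (R' : S.Dom → Φ → ℂ) : Prop :=
  ∀ φ, A φ = A' φ + ∑ X ∈ Finset.univ.filter (fun X => ¬ S.MeetsLF X), R' X φ
    + ∑ X ∈ Finset.univ.filter S.MeetsLF, R' X φ

/-- (1.101) is (1.98) regrouped: if the new action is `A′_k` plus the whole (1.98)-sum, it is `A′_k` plus the new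
𝐑-terms plus the new boundary terms.  Finite sums. [folklore] -/
theorem repr1101_of_198 {Φ : Type*} (A A' : Φ → ℂ) (R' : S.Dom → Φ → ℂ)
    (h198 : ∀ φ, A φ = A' φ + ∑ X, R' X φ) : Repr1101 S A A' R' := by
  intro φ
  rw [h198 φ, add_assoc, ← Finset.sum_filter_add_sum_filter_not Finset.univ S.MeetsLF (fun X => R' X φ),
    add_comm (∑ X ∈ Finset.univ.filter S.MeetsLF, R' X φ)]

/-- Under (1.101) the (1.100)-bounded part of the new action is the first sum: with the pointwise bound (1.100) on the
terms NOT meeting the large-field set and the tree-decay input, `‖Σ_{X: ¬MeetsLF} 𝐑′^{(k)}(X)‖ ≤ e^{−p₀(g_k)}K₀|π_k|`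
(the boundary terms are controlled separately by (1.99) in RELATIVE size, `B16.relDecay_not_fullDecay`). [cite: Balaban1989LargeFieldII, (1.100)–(1.101) p.390] -/
theorem norm_newR_le {Φ : Type*} (C : B12.CubeCover S.toLocDomainSys) (R' : S.Dom → Φ → ℂ)
    (p0val κ K₀ : ℝ) (φ : Φ)
    (h100 : ∀ X, ¬ S.MeetsLF X → ‖R' X φ‖ ≤ Real.exp (-p0val) * Real.exp (-κ * S.dj X))
    (hTree : ∀ cb : C.Cube, ∑ X ∈ C.above cb, Real.exp (-κ * S.dj X) ≤ K₀) :
    ‖∑ X ∈ Finset.univ.filter (fun X => ¬ S.MeetsLF X), R' X φ‖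
      ≤ Real.exp (-p0val) * K₀ * (Fintype.card C.Cube : ℝ) := by
  calc ‖∑ X ∈ Finset.univ.filter (fun X => ¬ S.MeetsLF X), R' X φ‖
        ≤ ∑ X ∈ Finset.univ.filter (fun X => ¬ S.MeetsLF X), ‖R' X φ‖ := norm_sum_le _ _
    _ ≤ ∑ X ∈ Finset.univ.filter (fun X => ¬ S.MeetsLF X), Real.exp (-p0val) * Real.exp (-κ * S.dj X) :=
        Finset.sum_le_sum fun X hX => h100 X (Finset.mem_filter.mp hX).2
    _ ≤ ∑ X, Real.exp (-p0val) * Real.exp (-κ * S.dj X) :=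
        Finset.sum_le_sum_of_subset_of_nonneg (Finset.filter_subset _ _) fun X _ _ => by positivity
    _ = Real.exp (-p0val) * ∑ X, Real.exp (-κ * S.dj X) := by rw [Finset.mul_sum]
    _ ≤ Real.exp (-p0val) * ((Fintype.card C.Cube : ℝ) * K₀) :=
        mul_le_mul_of_nonneg_left
          (sum_le_card_mul C _ (fun X => (Real.exp_pos _).le) K₀ hTree) (Real.exp_pos _).le
    _ = Real.exp (-p0val) * K₀ * (Fintype.card C.Cube : ℝ) := by ring

/-- **(1.102)** p. 390 [36], verbatim: *"The new large field region is equal to Z_k ∪ ⋃_{i=1}^m Y_i, and the operation 𝐓_k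
for a component Y of the set ⋃_{i=1}^m Y_i has the form 𝐓_k(Y) = χ^c_k(Y^{~−6}) χ_{k,Λ} δ_G(V_kV_Λ^{−1}) 𝐓′_k(Y). (1.102)"* —
the large-field operation of the induction hypothesis is the operation 𝐓′_k(Y) of (1.71) followed by MULTIPLICATION by
characteristic functions and the δ-function of the axial gauge (pp. 391–392: *"there are only the
characteristic functions, the δ-functions and the functions 𝐓′_k(Y_i)1 multiplying the action density"*).  READING NOTE
(v1.1; cell GAPS C-adv7-91, unit adv7-g43, `DIVERGENCE.md` D-f2.23): (1.102) AS PRINTED shows THREE factors in front of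
𝐓′_k(Y) — χ^c_k(Y^{~−6}), χ_{k,Λ}, δ_G(V_kV_Λ^{−1}) — whereas the same operation carries FOUR in (1.72) line 3, p. 379 [25]
(*"Π_{i=1}^m χ^c_k(Y_i^{~−6}) χ_{k,Λ_i} χ_i δ_{G_i}(V′_k) 𝐓′_k(Y_i)"*), in (1.104) line 1, p. 391 [37] (*"Π_{i=1}^m χ^c_k(Y_i^{~−6})
χ_{k,Λ_i} χ_i δ_{G_i}(V_kV_{Λ_i}^{−1})(𝐓′_k(Y_i)1)"*, quoted in full at `Repr1104`) and in the text p. 378 [24] (*"For the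
components of the second class, denoted by {Y_1,…,Y_m}, we have the large field characteristic functions χ^c_k(Y_i^{~−6}),
and the previous functions χ_{k,Λ_i}χ_i together with the δ-functions δ_{G_i}(V′_k), where Λ_i = Λ ∩ Y_i, G_i = G_0 ∩ Y_i"*):
the small-field characteristic function χ_i = χ(Λ_i) of [IV] (1.101) is dropped in (1.102) as printed (read as a misprint /
abbreviation, with Λ, G standing for Λ ∩ Y, G_0 ∩ Y).  The cell READS (1.102) as 𝐓_k(Y) = χ^c_k(Y^{~−6}) χ_{k,Λ∩Y} χ(Λ∩Y)
δ_{G_0∩Y}(V_kV_{Λ∩Y}^{−1}) 𝐓′_k(Y), consistently with (1.72), (1.104) and the factor `lf` of `Repr1104` below.  Not an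
analytic point: every factor in front of 𝐓′_k(Y) is a multiplier with values in [0,1] (resp. a gauge-fixing δ-function),
and the bounds (1.73)–(1.75), (1.89) concern 𝐓′_k(Y) alone (`B16Cor3Ops`: `𝐓_k(Y)1 ≤ 𝐓′_k(Y)1`).  Schematic:
operations as maps on functions of the configuration, ALL the multiplying factors (three as printed, four as read)
lumped into one multiplier `mult` — the `Prop` is unaffected by the count. [cite: Balaban1989LargeFieldII, (1.102) p.390] -/
def Form1102 {Φ : Type*} (mult : Φ → ℂ) (T' T : (Φ → ℂ) → Φ → ℂ) : Prop :=
  ∀ F φ, T F φ = mult φ * T' F φ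

/-- **(1.103)** p. 391 [37], verbatim: *"Let us make the final remark about another possible representation of the k^th
density. We divide the terms of the sum in (1.98) in the same way as before, and we consider the part of the
expression (1.72) with the product of the operations 𝐓′_k(Y_i) acting on the exponential in (1.98) with the boundary
terms only, in fact with the terms with localization domains intersecting ∪Y_i. We write this expression in the
following form Π_{i=1}^m (𝐓′_k(Y_i)1)[Π_{i=1}^m (𝐓′_k(Y_i)1)^{−1}𝐓′_k(Y_i) exp Σ 𝐁′^{(k)}(X)], (1.103) and we consider the
expression in the square bracket."* — the normalisation identity at a fixed configuration: for non-vanishing normalisations `t_i = 𝐓′_k(Y_i)1` ((1.74) p. 380: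
`|𝐓′_k(X,(𝐔,𝐉))1| ≥ (𝐓′_k(X,(𝐔,0))1) e^{−2 sup|σ|}` with `𝐓′_k(X,(𝐔,0))1` *"obviously positive, although it may be very
small"* — the positivity is the unprinted domain lemma of cell GAPS G-adv3-2a / G-B16-12) and any value `G` of the
operated expression, `Π t_i · [(Π t_i)⁻¹ · G] = G`.  Certified as an identity only (cell GAPS C-B16-8 as amended by
G-B16-11). [cite: Balaban1989LargeFieldII, (1.103) p.391] -/
theorem identity1103 {m : ℕ} (t : Fin m → ℂ) (G : ℂ) (ht : ∀ i, t i ≠ 0) :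
    (∏ i, t i) * ((∏ i, (t i)⁻¹) * G) = G := by
  rw [← mul_assoc, ← Finset.prod_mul_distrib]
  have h1 : ∏ i, t i * (t i)⁻¹ = 1 := Finset.prod_eq_one fun i _ => mul_inv_cancel₀ (ht i)
  rw [h1, one_mul]

end Displays

/-! ## 4. (1.104) as a structure, and the second exponentiation as a NAMED UNPRINTED LEAF (cell GAPS G-B16-11) -/

/-- **The second exponentiation of the "final remark"** p. 391 [37], verbatim (after (1.103)): *"We apply successively
the same steps as for the expression in the curly bracket in (1.72), so we describe now changes and differences only.
We apply the Mayer expansion, and we write the polymer expansion (1.90), using the fact that the 𝐓′_k-operations are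
normalized … Also, we use the ordinary notion of connectedness to define components. The activities are estimated as
in (1.92), with the corresponding changes, i.e., without the first two sums, the first product over h is replaced by
the product of e³ over indices i such that Y_i ⊂ X′, the number β is replaced by (1/4)β, and α by O(1)c₁. … We have
the inequality (1.93), but with the linear size d_k(X′∖∪Y_i) in the first exponential on the right-hand side, and
without the product over h. The sum over 𝐃 is estimated as in (1.94), and we get the bound (1.95) without the first
two sums and the first exponential. This bound is enough for the convergence of the exponentiated cluster expansion.
This requires a comment, because in this bound there are no tree decay exponential factors for the domains Y_i. In
fact, looking carefully at a standard proof of the convergence of the expansion (e.g., in [26]), we see that in the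
present situation such factors are not needed, because there are no summations over these domains, they are fixed.
Thus, we obtain (1.98) for the expression in the square bracket in (1.103). We denote the terms in the sum again by
𝐁′^{(k)}(X), because the domains X intersect ⋃_{i=1}^m Y_i."*  READING NOTE (v1.1; cell GAPS C-adv7-93, unit adv7-g43):
the elided clause reads in full *"using the fact that the 𝐓′_k-operations are normalized, i.e., if such an operation is
applied to a function which does not depend on the integration variables connected with the operation, then it is equal
to 1"* (p. 391 [37]); taken literally of 𝐓′_k(Y_i) this is a slip of the pen — 𝐓′_k(Y_i)1 is positive but in general
≠ 1 and *"may be very small"* ((1.74) p. 380, (1.89) p. 387), which is precisely why (1.103) divides by it: the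
NORMALIZED operations are the bracket operations (𝐓′_k(Y_i)1)⁻¹𝐓′_k(Y_i) of (1.103), which are the identity on functions
not depending on the Y_i-integration variables (at every configuration with 𝐓′_k(Y_i)1 ≠ 0, `identity1103`), and it is to
these that the Mayer / polymer expansion (1.90) is applied.  TYPED AS A HYPOTHESIS, never discharged here: the square bracket of (1.103) equals `exp Σ_{X meeting the large-field set} 𝐁″(X)` with new boundary
terms obeying a (1.99)-type bound in the RELATIVE size at some rate `r` and constant `Cα` (the printed substitutions
`β ↦ ¼β`, `α ↦ O(1)c₁`).  STATUS (cell GAPS G-B16-11, adjudicating G-adv3-4 against C-B16-8): objection UPHELD — the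
polymers containing a fixed `Y_i` are pairwise incompatible, the printed activity bound does not make their total
weight `< 1` uniformly in k, so no standard proof ([26] Cammarota; Kotecký–Preiss; Brydges) applies as printed;
(1.104) is not established and NOT load-bearing for Theorem 1 / Corollary 3. [cite: Balaban1989LargeFieldII, p.391 final remark] -/
def SecondExpLeaf (S : B16.RelDomainSys) [DecidablePred S.MeetsLF] {Φ : Type*} (bracket : Φ → ℂ)
    (B'' : S.Dom → Φ → ℂ) (dom : S.Dom → Set Φ) (Cα r : ℝ) : Prop :=
  (∀ φ, bracket φ = Complex.exp (∑ X ∈ Finset.univ.filter (fun X => S.MeetsLF X), B'' X φ)) ∧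
  (∀ X, S.MeetsLF X → ∀ φ ∈ dom X, ‖B'' X φ‖ ≤ Cα * Real.exp (-r * S.dRel X))

/-- **(1.104)** p. 391 [37], verbatim: *"We substitute the right-hand side of (1.98) into the expression for the effective
density, and we obtain 𝐑ρ_k = Σ_{Z_k} Σ_{{Y_1,…,Y_m}} χ_k (Σ_{{Ω^c_j,Z_j}} 𝐓″_k(Z_k)) Π_{i=1}^m χ^c_k(Y_i^{~−6}) χ_{k,Λ_i} χ_i
δ_{G_i}(V_kV_{Λ_i}^{−1})(𝐓′_k(Y_i)1) · exp[A′_k + Σ_X 𝐑′^{(k)}(X) + Σ_X 𝐁′^{(k)}(X)]. (1.104)"* and pp. 391–392: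
*"there are no integral operations connected with them [the Y_i] … hence 𝐓_k(Y_i) is the multiplication operation. …
The contributions from the previous large field regions is isolated in these boundary terms, and in the functions
𝐓′_k(Y_i)1."*  STRUCTURE only, on REAL configurations `Cfg` (= `V_k`): a finite index type of pairs `(Z_k, {Y_i})`
(`Adm`), the characteristic function `χ a`, the history-summed live operation `hist a` = `Σ_{{Ω^c_j,Z_j}} 𝐓″_k(Z_k)` as
an abstract map on functions of `V_k` (the identity for `Z_k = ∅`: the empty region has the single empty history and
no operation), the multiplication factor `lf a` = `Π_i χ^c_k χ_{k,Λ_i} χ_i δ_{G_i} (𝐓′_k(Y_i)1)` (`= 1` for `m = 0`), the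
real exponent `expo a` = `A′_k + Σ𝐑′^{(k)} + Σ𝐁′^{(k)}` (its reality on real fields is leaf L1; for the all-small index
there are no 𝐁′-terms, cell GAPS C-B16-9), and the distinguished index `allSmall` = `(∅, ∅)`.  Depends on
`SecondExpLeaf` for its derivation from (1.72)+(1.98) (G-B16-11); typed for the record, relied on by nothing. [cite: Balaban1989LargeFieldII, (1.104) p.391] -/
structure Repr1104 (Cfg : Type*) where
  Adm : Type
  [finAdm : Fintype Adm]
  χ : Adm → Cfg → ℝ
  hist : Adm → (Cfg → ℝ) → Cfg → ℝ
  lf : Adm → Cfg → ℝ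
  expo : Adm → Cfg → ℝ
  allSmall : Adm
  hist_allSmall : ∀ F, hist allSmall F = F
  lf_allSmall : ∀ V, lf allSmall V = 1

/-- The index set of (1.104) is finite (finitely many regions and histories on the finite lattice `T^{(k)}_1`, p. 379
(1.72): sums over `Z_k`, `{Y_1,…,Y_m}`, `{Ω^c_j, Z_j}`); exposes the field `Repr1104.finAdm` (same pattern as
`B12TreeDecay.CubeSystem.instFintypeCube`). [cite: Balaban1989LargeFieldII, (1.72) p.379] -/
instance Repr1104.instFintypeAdm {Cfg : Type*} (R : Repr1104 Cfg) : Fintype R.Adm := R.finAdm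

/-- (1.104) HOLDS for the density `Rρ` (= `𝐑ρ_k` as a function of `V_k`): `𝐑ρ_k(V) = Σ_a χ_a(V) · (hist_a [lf_a ·
exp expo_a])(V)`. [cite: Balaban1989LargeFieldII, (1.104) p.391] -/
def Repr1104.Holds {Cfg : Type*} (R : Repr1104 Cfg) (Rρ : Cfg → ℝ) : Prop :=
  ∀ V, Rρ V = ∑ a, R.χ a V * R.hist a (fun V' => R.lf a V' * Real.exp (R.expo a V')) V

/-- The `Z_k = ∅, m = 0` summand of (1.104) — p. 391's "term without large field regions" — has the form `χ(V) ·
exp[expo(V)]` consumed by `allSmall_lower` (with `expo = A′_k + Σ_X 𝐑′^{(k)}(X)`).  Definitional. [folklore] -/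
theorem Repr1104.allSmall_term {Cfg : Type*} (R : Repr1104 Cfg) (V : Cfg) :
    R.χ R.allSmall V * R.hist R.allSmall (fun V' => R.lf R.allSmall V' * Real.exp (R.expo R.allSmall V')) V
      = R.χ R.allSmall V * Real.exp (R.expo R.allSmall V) := by
  rw [R.hist_allSmall, R.lf_allSmall, one_mul]

/-- (1.104) read as (2.18)-data for `B14Cor3`: the summands `a ↦ χ_a · hist_a[lf_a e^{expo_a}]` with majorants
`major` and the all-small index give a `B14Cor3.TermData` for the run's density at step `k` WHEN `𝐑ρ_k` is the density
the bound is stated for (which density (0.1) bounds — `ρ_k` or `𝐑ρ_k` — is the run datum `D.ρ k`; 𝐑 preserves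
integrals, [IV] (0.4), not values).  Bookkeeping constructor; `Holds` transfers verbatim. [folklore] -/
noncomputable def Repr1104.toTermData {D : B16.RunData} {k : ℕ} (R : Repr1104 (D.Cfg k)) (major : R.Adm → ℝ) :
    B14Cor3.TermData D k where
  Adm := R.Adm
  term a V := R.χ a V * R.hist a (fun V' => R.lf a V' * Real.exp (R.expo a V')) V
  major := major
  allSmall := R.allSmall

/-- If (1.104) holds for `D.ρ k` then the associated (2.18)-data holds (`B14Cor3.TermData.Holds`), so the sibling's
`uvIneq_of_termData` / `uvIneq_of_structure` apply to it exactly as to (1.72)+(1.98). [folklore] -/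
theorem Repr1104.termData_holds {D : B16.RunData} {k : ℕ} (R : Repr1104 (D.Cfg k)) (major : R.Adm → ℝ)
    (h : R.Holds (D.ρ k)) : (R.toTermData major).Holds :=
  h

end Literature.MathematicalPhysics.QuantumFieldTheory.Balaban1983to89.B16Cor3
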